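import Mathlib
import Summits.ValiantsHypothesis.ValiantsHypothesis.Theorems.NNDivisionHard.Negative.CliqueRowLawFalse
import Summits.ValiantsHypothesis.ValiantsHypothesis.Theorems.NNDivisionHard.Negative.DiagTiltedLawFalse
import Summits.ValiantsHypothesis.ValiantsHypothesis.Theorems.FifoMatchingNNDivisionHardLowDimFace
import Literature.Barriers.PneNP.TSPExtensionComplexityKaibelWeltge
import Literature.Barriers.PneNP.TSPExtensionComplexityHyperplaneBound
import HarnessLib


/-!
# ROW FAMILIES AND THEIR LAWS for `COR(n) + Q` (crux `NNDivisionHard`, stmt-ValiantsHypothesis-21181; line `virtual_passenger`) — part 1/8 of the `LocatedRows` port: §1 the frame (`RowFamily`, `Law`, `Emb`, `allRows`, `entryTilted`, `LocatedPencilLaw`, `pinnedRows`), §2 the law-currency located block count, §3 (= workfile §4e) the EXACT family `hCOR` / `exactTilted` / `ExactPencilLaw` and the chain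

Theorems-side port (staged by val-idea-40 g5 for the desk's P-W6b hand; declaration texts VERBATIM, namespace `…Theorems.FifoMatching.LocatedRows`) of val-idea-40 g5's crux workfile `Cruxes/NNDivisionHard/LocatedRows.lean` REV 5 @4b120a7727c3 (sha16 18e097fc3d9fe11e, 1953 l.; critic of record val-idea-crit-9 g2 VERDICTS #48 / #54 / #58: VERIFIED KEEP, axioms standard), split by the 400-line cap into seven chained modules `…RowFamilies` (§1, §2, §4e-frame) → `…LocatedRowsZeroDiag` (§3) → `…LocatedRowsPairPencil` (§4) → `…LocatedRowsPinExposed` (§4b) → `…LocatedRowsColumnCoupled` (§4c) → `…LocatedRowsPermutahedron` (§4c′, §4d) → `…LocatedRowsCeiling` (§5, §5b).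

* frame of val-idea-39 g3's `Cruxes/NNDivisionHard/CliqueRowBlind.lean` §4 (restated verbatim); exact family of val-idea-38 g2's `Cruxes/NNDivisionHard/ExactPencil38.lean` (verbatim); `pinnedRows`, `three_pow_le_of_block`, `pinnedRows_emb_exactTilted`, `exact_body_of_pinned_body` (restriction principle), `exact_law_chain` (val-idea-40 g5).
* `CorVirtualHardN`, `RowFamily.Law`, `LocatedPencilLaw` (REFUTED on paper, crit-9 N22), `ExactPencilLaw` (law of record, OPEN) are TYPED, not asserted.

HONEST LABEL: helper rows for an OPEN crux (21181 `NNDivisionHard` OPEN; `ExactPencilLaw`, `allRows.Law`, COR-VIRTUAL OPEN); the `Law`s are `Prop`-valued definitions, nothing open is asserted; VP ≠ VNP is NOT proved.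
-/

set_option autoImplicit false

-- the mandated summit-side namespace repeats a component by design (single-problem summit)
set_option linter.dupNamespace false

noncomputable section

open Matrix Finset
open scoped Pointwise

namespace Summit.ValiantsHypothesis.ValiantsHypothesis.Theorems.FifoMatching.LocatedRows

open Literature.Barriers.PneNP (HasEFOfSize three_pow_le_card_mul_two_pow_of_cover_univ)
open Literature.Combinatorics.Optimization.FixedSizePsdRank (Cube bvec flat vecOuter corPolytope flat_dotProduct_vecOuter
  flat_dotProduct_le_of_mem_corPolytope)
open Summit.ValiantsHypothesis.ValiantsHypothesis.Theorems.FifoMatching.XcDivision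
  (udInd udPt udRow udMat udInd_apply udInd_sq udInd_inter ud_data udRow_dotProduct_flat_diagonal flat_dotProduct_flat
    dot_le_of_mem_convexHull)
open Summit.ValiantsHypothesis.Theorems.NNDivisionHardNegative.CliqueRowBlind (sum_udInd_mem sum_udInd_univ)
open Summit.ValiantsHypothesis.Theorems.NNDivisionHardNegative.DiagTilted
  (qOff qOffMat qOff_eq hasEFOfSize_qOff udRow_dotProduct_qOff udInd_compl udInd_univ)

/-! ## §1 Row families and their laws (frame of `CliqueRowBlind.lean` §4, verbatim) and the located family `pinnedRows` -/

/-- the line's budget scale `T c n = 2^{(log₂ n + c)^c}` (verbatim `XcDivision.T`). -/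
def T (c n : ℕ) : ℕ := 2 ^ ((Nat.log 2 n + c) ^ c)

/-- COR-VIRTUAL in the flat `corPolytope n` currency — verbatim `CliqueRowBlind.CorVirtualHardN` / `RecourseGraph.CorVirtualHardN`. -/
def CorVirtualHardN : Prop :=
  ∀ c : ℕ, ∃ n₀ : ℕ, ∀ n ≥ n₀, ∀ (K : ℕ) (q : Fin (K + 1) → (Fin (n * n) → ℝ)) (r : ℕ),
    HasEFOfSize (corPolytope n + convexHull ℝ (Set.range q)) r →
      HasEFOfSize (convexHull ℝ (Set.range q)) r → T c n < r

/-- A ROW FAMILY for the correlation polytopes (verbatim `CliqueRowBlind.RowFamily`). -/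
structure RowFamily where
  A : ℕ → Type
  ρ : ∀ n, A n → (Fin (n * n) → ℝ)
  β : ∀ n, A n → ℝ
  valid : ∀ n (a : A n), ∀ x ∈ corPolytope n, ρ n a ⬝ᵥ x ≤ β n a

/-- **THE `F`-ROW LAW** (verbatim `CliqueRowBlind.RowFamily.Law`). -/
def RowFamily.Law (F : RowFamily) : Prop :=
  ∀ c : ℕ, ∃ n₀ : ℕ, ∀ n ≥ n₀, ∀ (K : ℕ) (q : Fin (K + 1) → (Fin (n * n) → ℝ)) (r : ℕ),
    HasEFOfSize (convexHull ℝ (Set.range q)) r →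
    ∀ m : F.A n → ℝ, (∀ a j, F.ρ n a ⬝ᵥ q j ≤ m a) → (∀ a, ∃ j, F.ρ n a ⬝ᵥ q j = m a) →
    ∀ (U : F.A n → Option (Fin r) → ℝ) (V : Finset (Fin n) × Fin (K + 1) → Option (Fin r) → ℝ),
      (∀ a i, 0 ≤ U a i) → (∀ p i, 0 ≤ V p i) →
      (∀ a b j, (F.β n a + m a) - F.ρ n a ⬝ᵥ (udPt b + q j) = ∑ i, U a i * V (b, j) i) → T c n < r

/-- ★ EVERY ROW-FAMILY LAW IMPLIES COR-VIRTUAL (Yannakakis once; verbatim `CliqueRowBlind.corVirtualHardN_of_law`). -/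
theorem corVirtualHardN_of_law (F : RowFamily) (hL : F.Law) : CorVirtualHardN := by
  classical
  intro c
  obtain ⟨n₀, hn₀⟩ := hL c
  refine ⟨n₀, fun n hn K q r hR hQ => ?_⟩
  obtain ⟨pt_mem, -, -, -⟩ := ud_data n
  let m : F.A n → ℝ := fun a =>
    Finset.univ.sup' Finset.univ_nonempty (fun j : Fin (K + 1) => F.ρ n a ⬝ᵥ q j)
  have hmax : ∀ a, ∃ j, F.ρ n a ⬝ᵥ q j = m a := fun a => by
    obtain ⟨j, -, hj⟩ := Finset.exists_mem_eq_sup' Finset.univ_nonempty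
      (fun j : Fin (K + 1) => F.ρ n a ⬝ᵥ q j)
    exact ⟨j, hj.symm⟩
  have hmq : ∀ a j, F.ρ n a ⬝ᵥ q j ≤ m a := fun a j =>
    Finset.le_sup' (fun j : Fin (K + 1) => F.ρ n a ⬝ᵥ q j) (Finset.mem_univ j)
  have hm : ∀ a, ∀ y ∈ convexHull ℝ (Set.range q), F.ρ n a ⬝ᵥ y ≤ m a := fun a =>
    dot_le_of_mem_convexHull _ _ _ (by rintro _ ⟨j, rfl⟩; exact hmq a j)
  have hq : ∀ j, q j ∈ convexHull ℝ (Set.range q) := fun j => subset_convexHull ℝ _ ⟨j, rfl⟩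
  have hv : ∀ p : Finset (Fin n) × Fin (K + 1),
      udPt p.1 + q p.2 ∈ corPolytope n + convexHull ℝ (Set.range q) :=
    fun p => Set.add_mem_add (pt_mem p.1) (hq p.2)
  have hvalid : ∀ a, ∀ x ∈ corPolytope n + convexHull ℝ (Set.range q), F.ρ n a ⬝ᵥ x ≤ F.β n a + m a := by
    rintro a x ⟨p, hp, y, hy, rfl⟩
    rw [dotProduct_add]
    exact add_le_add (F.valid n a p hp) (hm a y hy)
  obtain ⟨U, V, hU, hV, hfac⟩ := Literature.Barriers.PneNP.HasEFOfSize.exists_nonneg_factorization hR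
    (fun p : Finset (Fin n) × Fin (K + 1) => udPt p.1 + q p.2) hv (F.ρ n) (fun a => F.β n a + m a) hvalid
  exact hn₀ n hn K q r hQ m hmq hmax U V hU hV (fun a b j => hfac a (b, j))

/-- An EMBEDDING of row families (verbatim `CliqueRowBlind.RowFamily.Emb`). -/
structure RowFamily.Emb (F G : RowFamily) where
  φ : ∀ n, F.A n → G.A n
  ρ_eq : ∀ n a, G.ρ n (φ n a) = F.ρ n a
  β_eq : ∀ n a, G.β n (φ n a) = F.β n a

/-- ★ LAWS ARE MONOTONE along embeddings (verbatim `CliqueRowBlind.RowFamily.Law.mono`). -/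
theorem RowFamily.Law.mono {F G : RowFamily} (e : RowFamily.Emb F G) (hF : F.Law) : G.Law := by
  intro c
  obtain ⟨n₀, hn₀⟩ := hF c
  refine ⟨n₀, fun n hn K q r hQ m hmq hmax U V hU hV hfac => ?_⟩
  refine hn₀ n hn K q r hQ (fun a => m (e.φ n a)) (fun a j => ?_) (fun a => ?_)
    (fun a => U (e.φ n a)) V (fun a i => hU _ i) hV (fun a b j => ?_)
  · rw [← e.ρ_eq n a]; exact hmq _ j
  · obtain ⟨j, hj⟩ := hmax (e.φ n a); exact ⟨j, by rw [← e.ρ_eq n a]; exact hj⟩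
  · rw [← e.ρ_eq n a, ← e.β_eq n a]; exact hfac _ b j

/-- ALL valid rows (verbatim `CliqueRowBlind.allRows`). -/
@[reducible] def allRows : RowFamily where
  A := fun n => {cd : (Fin (n * n) → ℝ) × ℝ // ∀ x ∈ corPolytope n, cd.1 ⬝ᵥ x ≤ cd.2}
  ρ := fun _ a => a.1.1
  β := fun _ a => a.1.2
  valid := fun _ a => a.2

/-- box validity: `⟨flat W, x⟩ ≤ Σ_{i,m} max(W_im, 0)` on `COR(n)` (verbatim `CliqueRowBlind.flat_le_box`). -/
theorem flat_le_box {n : ℕ} (W : Matrix (Fin n) (Fin n) ℝ) :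
    ∀ x ∈ corPolytope n, flat W ⬝ᵥ x ≤ ∑ i, ∑ m, max (W i m) 0 := by
  intro y hy
  refine flat_dotProduct_le_of_mem_corPolytope hy ⟨(W, ∑ i, ∑ m, max (W i m) 0), fun x hx => ?_⟩
  refine Finset.sum_le_sum fun i _ => Finset.sum_le_sum fun m _ => ?_
  rcases hx i with hi | hi <;> rcases hx m with hm | hm <;> simp [hi, hm]

/-- **C⁺ = `LocatedPencilLaw` := `entryTilted.Law`** (verbatim `CliqueRowBlind.entryTilted`): clique rows tilted by an
ARBITRARY matrix direction with the box right-hand side `udRow a + flat W ≤ 1 + Σ max(W_im, 0)`. -/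
@[reducible] def entryTilted : RowFamily where
  A := fun n => Finset (Fin n) × Matrix (Fin n) (Fin n) ℝ
  ρ := fun _ a => udRow a.1 + flat a.2
  β := fun _ a => 1 + ∑ i, ∑ m, max (a.2 i m) 0
  valid := fun n a x hx => by
    rw [add_dotProduct]
    exact add_le_add ((ud_data n).2.1 a.1 x hx) (flat_le_box a.2 x hx)

/-- `C⁺ := entryTilted.Law` under its card name (verbatim). -/
def LocatedPencilLaw : Prop := entryTilted.Law

/-- ★ **THE LOCATED FAMILY WITH EXACT RIGHT-HAND SIDES** (`pinnedRows`; C⁺_loc := `pinnedRows.Law`): clique rows tilted by ANY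
direction `w` that is maximised over `COR(n)` at a coordinate vertex `x_S = udPt S`, with the EXACT right-hand side
`1 + ⟨w, x_S⟩`: `udRow a + w ≤ 1 + ⟨w, x_S⟩`.  Every row located at a coordinate face `F_{S,S'}` (a direction in its normal cone)
is a member (it is maximised at the vertex `x_S ∈ F_{S,S'}`); so are PROP B's diagonal reads, the pair pencils of §3, the
switched-face rows `±E_im` and PROP E's gadget rows (`a = ∅`, `w = μ·andDir + D_{a'}`, maximised at a 2-element vertex). -/
@[reducible] def pinnedRows : RowFamily where
  A := fun n => Finset (Fin n) ×
    {wS : (Fin (n * n) → ℝ) × Finset (Fin n) // ∀ x ∈ corPolytope n, wS.1 ⬝ᵥ x ≤ wS.1 ⬝ᵥ udPt wS.2}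
  ρ := fun _ a => udRow a.1 + a.2.1.1
  β := fun _ a => 1 + a.2.1.1 ⬝ᵥ udPt a.2.1.2
  valid := fun n a x hx => by
    rw [add_dotProduct]
    exact add_le_add ((ud_data n).2.1 a.1 x hx) (a.2.2 x hx)

/-- `pinnedRows ↪ allRows`. -/
def pinnedRows_emb_allRows : RowFamily.Emb pinnedRows allRows where
  φ := fun n a => ⟨(pinnedRows.ρ n a, pinnedRows.β n a), pinnedRows.valid n a⟩
  ρ_eq := fun _ _ => rfl
  β_eq := fun _ _ => rfl

/-- ★ `C⁺_loc ⟹ allRows.Law ⟹ COR-VIRTUAL` (PROVED). -/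
theorem corVirtualHardN_of_pinnedRowsLaw (h : pinnedRows.Law) : CorVirtualHardN :=
  corVirtualHardN_of_law allRows (RowFamily.Law.mono pinnedRows_emb_allRows h)

/-! ## §2 ★ The law-currency located block count -/

/-- ★★ **LAW-CURRENCY LOCATED BLOCK COUNT.**  If a matrix with a nonnegative factorization through the slot type `ι`,
`M ρ κ = Σ_i U ρ i · V κ i`, contains an embedded unique-disjointness block — rows `row a'`, columns `col b'` (`a' b' ⊆ α`) on
which `M (row a') (col b') = (1 − |a' ∩ b'|)²` — then `3^{|α|} ≤ |ι| · 2^{|α|}`: the support rectangles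
`{a' : U > 0} × {b' : V > 0}` of the slots avoid `|a'∩b'| = 1` and cover the disjoint pairs (Kaibel–Weltge). -/
theorem three_pow_le_of_block {R C ι α : Type*} [Fintype ι] [Fintype α] [DecidableEq α]
    (U : R → ι → ℝ) (V : C → ι → ℝ) (hU : ∀ ρ i, 0 ≤ U ρ i) (hV : ∀ κ i, 0 ≤ V κ i)
    (row : Finset α → R) (col : Finset α → C)
    (hblock : ∀ a b : Finset α, ∑ i, U (row a) i * V (col b) i = (1 - ((a ∩ b).card : ℝ)) ^ 2) :
    3 ^ Fintype.card α ≤ Fintype.card ι * 2 ^ Fintype.card α := by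
  classical
  have key := three_pow_le_card_mul_two_pow_of_cover_univ (α := α) (Finset.univ : Finset ι)
    (fun i => {a : Finset α | 0 < U (row a) i}) (fun i => {b : Finset α | 0 < V (col b) i}) ?_ ?_
  · rwa [Finset.card_univ] at key
  · intro i _ a ha b hb h1
    have ha' : 0 < U (row a) i := ha
    have hb' : 0 < V (col b) i := hb
    have hsum := hblock a b
    rw [h1, Nat.cast_one, sub_self] at hsum
    have hle : U (row a) i * V (col b) i ≤ ∑ j, U (row a) j * V (col b) j :=
      Finset.single_le_sum (fun j _ => mul_nonneg (hU _ j) (hV _ j)) (Finset.mem_univ i)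
    rw [hsum] at hle
    norm_num at hle
    exact absurd hle (not_le.mpr (mul_pos ha' hb'))
  · intro a b hab
    have hsum := hblock a b
    rw [Finset.disjoint_iff_inter_eq_empty.mp hab, Finset.card_empty, Nat.cast_zero, sub_zero, one_pow] at hsum
    have hpos : 0 < ∑ j, U (row a) j * V (col b) j := by rw [hsum]; exact one_pos
    obtain ⟨j, -, hj⟩ : ∃ j ∈ (Finset.univ : Finset ι), 0 < U (row a) j * V (col b) j := by
      by_contra h
      push Not at h
      exact absurd (Finset.sum_nonpos h) (not_le.mpr hpos)
    have hUj : 0 < U (row a) j := lt_of_le_of_ne (hU _ j) (fun h => by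
      rw [← h, zero_mul] at hj; exact lt_irrefl _ hj)
    have hVj : 0 < V (col b) j := lt_of_le_of_ne (hV _ j) (fun h => by
      rw [← h, mul_zero] at hj; exact lt_irrefl _ hj)
    exact ⟨j, Finset.mem_univ _, hUj, hVj⟩


/-! ## §3 (workfile §4e) The EXACT family — the law of record after N22: C⁺_exact = `ExactPencilLaw` -/

section ExactCurrency
variable {n : ℕ}

/-- (verbatim 38 g2 `ExactPencil38.hCOR`) the EXACT support value `h_COR(W) = max_b ⟨flat W, 𝟙_b𝟙_bᵀ⟩`. -/
noncomputable def hCOR (W : Matrix (Fin n) (Fin n) ℝ) : ℝ :=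
  Finset.univ.sup' Finset.univ_nonempty (fun b : Finset (Fin n) => flat W ⬝ᵥ udPt b)

/-- `⟨flat W, x_b⟩ ≤ h_COR(W)`. -/
theorem le_hCOR (W : Matrix (Fin n) (Fin n) ℝ) (b : Finset (Fin n)) : flat W ⬝ᵥ udPt b ≤ hCOR W :=
  Finset.le_sup' (fun b : Finset (Fin n) => flat W ⬝ᵥ udPt b) (Finset.mem_univ b)

/-- `h_COR(W)` is attained at some clique vertex. -/
theorem exists_eq_hCOR (W : Matrix (Fin n) (Fin n) ℝ) : ∃ b : Finset (Fin n), flat W ⬝ᵥ udPt b = hCOR W := by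
  obtain ⟨b, -, hb⟩ := Finset.exists_mem_eq_sup' Finset.univ_nonempty
    (fun b : Finset (Fin n) => flat W ⬝ᵥ udPt b)
  exact ⟨b, hb.symm⟩

/-- (verbatim 38 g2) validity of the exact row `flat W ≤ h_COR(W)` on `COR(n)`. -/
theorem flat_le_hCOR (W : Matrix (Fin n) (Fin n) ℝ) : ∀ x ∈ corPolytope n, flat W ⬝ᵥ x ≤ hCOR W := by
  classical
  intro y hy
  refine flat_dotProduct_le_of_mem_corPolytope hy ⟨(W, hCOR W), fun x hx => ?_⟩
  let b : Finset (Fin n) := Finset.univ.filter (fun i => x i = 1)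
  have hxb : udInd b = x := by
    funext i
    rw [udInd_apply]
    rcases hx i with h | h
    · have : i ∉ b := by simp [b, h]
      rw [if_neg this, h]
    · have : i ∈ b := by simp [b, h]
      rw [if_pos this, h]
  have key : flat W ⬝ᵥ udPt b = ∑ i, ∑ j, W i j * (x i * x j) := by
    show flat W ⬝ᵥ vecOuter n (udInd b) = _
    rw [flat_dotProduct_vecOuter, hxb]
  have := le_hCOR W b
  rw [key] at this
  exact this

/-- `h_COR(W) ≤ Σ max(W_im, 0)` (verbatim 38 g2): the exact rhs is tighter than the box rhs. -/
theorem hCOR_le_box (W : Matrix (Fin n) (Fin n) ℝ) : hCOR W ≤ ∑ i, ∑ m, max (W i m) 0 := by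
  obtain ⟨b, hb⟩ := exists_eq_hCOR W
  rw [← hb]
  exact flat_le_box W _ ((ud_data n).1 b)

/-- ★ (verbatim 38 g2 `ExactPencil38.exactTilted`) the EXACTLY TILTED clique rows `udRow a + flat W ≤ 1 + h_COR(W)`. -/
@[reducible] noncomputable def exactTilted : RowFamily where
  A := fun n => Finset (Fin n) × Matrix (Fin n) (Fin n) ℝ
  ρ := fun _ a => udRow a.1 + flat a.2
  β := fun _ a => 1 + hCOR a.2
  valid := fun n a x hx => by
    rw [add_dotProduct]
    exact add_le_add ((ud_data n).2.1 a.1 x hx) (flat_le_hCOR a.2 x hx)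

/-- ★ (verbatim 38 g2) `ExactPencilLaw := exactTilted.Law` — C⁺_exact, the law of record after N22. -/
def ExactPencilLaw : Prop := exactTilted.Law

/-- `exactTilted ↪ allRows`, hence `ExactPencilLaw → COR-VIRTUAL`. -/
noncomputable def exactTilted_emb_allRows : RowFamily.Emb exactTilted allRows where
  φ := fun n a => ⟨(exactTilted.ρ n a, exactTilted.β n a), exactTilted.valid n a⟩
  ρ_eq := fun _ _ => rfl
  β_eq := fun _ _ => rfl

/-- `ExactPencilLaw → COR-VIRTUAL`. -/
theorem corVirtualHardN_of_exactPencilLaw (h : ExactPencilLaw) : CorVirtualHardN :=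
  corVirtualHardN_of_law allRows (RowFamily.Law.mono exactTilted_emb_allRows h)

/-- un-flattening a vector of `ℝ^{n²}` to a matrix. -/
def unflat (w : Fin (n * n) → ℝ) : Matrix (Fin n) (Fin n) ℝ := fun i j => w (finProdFinEquiv (i, j))

/-- `flat ∘ unflat = id`. -/
@[simp] theorem flat_unflat (w : Fin (n * n) → ℝ) : flat (unflat w) = w := by
  funext p
  show w (finProdFinEquiv ((finProdFinEquiv.symm p).1, (finProdFinEquiv.symm p).2)) = w p
  rw [Prod.mk.eta, Equiv.apply_symm_apply]

/-- a direction maximised over `COR(n)` at the vertex `x_S` has exact support value `⟨w, x_S⟩`. -/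
theorem hCOR_unflat_of_pinned {w : Fin (n * n) → ℝ} {S : Finset (Fin n)}
    (h : ∀ x ∈ corPolytope n, w ⬝ᵥ x ≤ w ⬝ᵥ udPt S) : hCOR (unflat w) = w ⬝ᵥ udPt S := by
  refine le_antisymm ?_ ?_
  · refine Finset.sup'_le _ _ fun b _ => ?_
    rw [flat_unflat]
    exact h _ ((ud_data n).1 b)
  · have := le_hCOR (unflat w) S
    rwa [flat_unflat] at this

/-- ★ every PINNED row is an EXACT row: `(a, (w, S)) ↦ (a, unflat w)` preserves functional and right-hand side. -/
noncomputable def pinnedRows_emb_exactTilted : RowFamily.Emb pinnedRows exactTilted where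
  φ := fun _ a => (a.1, unflat a.2.1.1)
  ρ_eq := fun _ a => by
    show udRow a.1 + flat (unflat a.2.1.1) = udRow a.1 + a.2.1.1
    rw [flat_unflat]
  β_eq := fun _ a => by
    show 1 + hCOR (unflat a.2.1.1) = 1 + a.2.1.1 ⬝ᵥ udPt a.2.1.2
    rw [hCOR_unflat_of_pinned a.2.2]

/-- hence `pinnedRows.Law → ExactPencilLaw` (C⁺_loc ⟹ C⁺_exact: the sub-family's law is the stronger statement) … -/
theorem exactPencilLaw_of_pinnedRowsLaw (h : pinnedRows.Law) : ExactPencilLaw :=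
  RowFamily.Law.mono pinnedRows_emb_exactTilted h

/-- ★ … and, pointwise, THE RESTRICTION PRINCIPLE: at any passenger `q` and size `r`, if the body of the `pinnedRows`-law
yields `C`, then so does the body of the `exactTilted`-law (restrict the exact family's data along the embedding). -/
theorem exact_body_of_pinned_body {K r : ℕ} (q : Fin (K + 1) → (Fin (n * n) → ℝ)) {C : Prop}
    (hbody : ∀ mm : pinnedRows.A n → ℝ, (∀ a j, pinnedRows.ρ n a ⬝ᵥ q j ≤ mm a) →
      (∀ a, ∃ j, pinnedRows.ρ n a ⬝ᵥ q j = mm a) →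
      ∀ (U : pinnedRows.A n → Option (Fin r) → ℝ) (V : Finset (Fin n) × Fin (K + 1) → Option (Fin r) → ℝ),
        (∀ a i, 0 ≤ U a i) → (∀ p i, 0 ≤ V p i) →
        (∀ a b j, (pinnedRows.β n a + mm a) - pinnedRows.ρ n a ⬝ᵥ (udPt b + q j) = ∑ i, U a i * V (b, j) i) → C) :
    ∀ mm : exactTilted.A n → ℝ, (∀ a j, exactTilted.ρ n a ⬝ᵥ q j ≤ mm a) →
      (∀ a, ∃ j, exactTilted.ρ n a ⬝ᵥ q j = mm a) →
      ∀ (U : exactTilted.A n → Option (Fin r) → ℝ) (V : Finset (Fin n) × Fin (K + 1) → Option (Fin r) → ℝ),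
        (∀ a i, 0 ≤ U a i) → (∀ p i, 0 ≤ V p i) →
        (∀ a b j, (exactTilted.β n a + mm a) - exactTilted.ρ n a ⬝ᵥ (udPt b + q j) = ∑ i, U a i * V (b, j) i) → C := by
  intro mm hle hat U V hU hV hfac
  let φ := pinnedRows_emb_exactTilted.φ n
  have hρ : ∀ a, exactTilted.ρ n (φ a) = pinnedRows.ρ n a := pinnedRows_emb_exactTilted.ρ_eq n
  have hβ : ∀ a, exactTilted.β n (φ a) = pinnedRows.β n a := pinnedRows_emb_exactTilted.β_eq n
  refine hbody (fun a => mm (φ a)) (fun a j => ?_) (fun a => ?_) (fun a => U (φ a)) V (fun a i => hU _ i) hV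
    (fun a b j => ?_)
  · rw [← hρ]; exact hle (φ a) j
  · obtain ⟨j, hj⟩ := hat (φ a)
    exact ⟨j, by rw [← hρ]; exact hj⟩
  · rw [← hρ, ← hβ]; exact hfac (φ a) b j

/-- ★ THE IMPLICATION CHAIN (laws, strongest first): `pinnedRows.Law → ExactPencilLaw → allRows.Law → COR-VIRTUAL`. -/
theorem exact_law_chain :
    (pinnedRows.Law → ExactPencilLaw) ∧ (ExactPencilLaw → allRows.Law) ∧ (allRows.Law → CorVirtualHardN) :=
  ⟨exactPencilLaw_of_pinnedRowsLaw, fun h => RowFamily.Law.mono exactTilted_emb_allRows h,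
    fun h => corVirtualHardN_of_law allRows h⟩

end ExactCurrency

end Summit.ValiantsHypothesis.ValiantsHypothesis.Theorems.FifoMatching.LocatedRows
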